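import Summits.QuantumAdvantage.QuantumAdvantage.Theorems.HintDialDuality

/-!
# HintDialLevels — module 2/10 of the HintDial THEOREMS package (cell decomp-qadv, lens-3 generation 6)

§3: the hint dial `HintSlice k` (positional degree, agreement from level `k`), monotonicity, `HintSlice 1 = SignedExactCubicSliceANF`, disjointness, junction with the TrustDial trust form (`trustForm`, `trustCl`, `trustCl_anti`, levels 1–4).

Provenance: split of the farm-checked single file `HintDialTheorems.lean` (HOME/decomp-qadv-lens-3/g6/tree/; rc 0 · no proof holes ·
axioms ⊆ {propext, Classical.choice, Quot.sound}); mathematical record: HOME/decomp-qadv-lens-3/g6/NODE-g6.md.  Modules in order: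
HintDialDuality → HintDialLevels → HintDialAutomaton → HintDialLeakLaw → HintDialPlanting → HintDialClosure → HintDialTable → HintDialLowDegree → HintDialAnfLadder → HintDialCovariance (each imports its predecessor).  Namespace `Summit.QuantumAdvantage.QuantumAdvantage.Theorems.HintDial`.
-/

set_option linter.dupNamespace false

noncomputable section

namespace Summit.QuantumAdvantage.QuantumAdvantage.Theorems.HintDial

open Finset
open Literature.Computability.Complexity
open Literature.Computability.QuantumComplexity
open Literature.Computability.MetaComplexity
open _root_.Computability (encodeNat)
/-! ## §3 ★ THE HINT DIAL

Position `(i,j,l)` of a cubic table carries the ANF coefficient of the monomial `x_i x_j x_l`, of degree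
`posDeg i j l = #{i,j,l} ∈ {1,2,3}`.  HINT LEVEL `k`: the solver is given `F` (even arity) which HAS an exact `+1` partner
`G₀` (= `F` is bent with a cubic-presentable dual; `G₀` is then unique as a function, §2), and a table `G` that AGREES WITH
`G₀` AT EVERY POSITION OF DEGREE `≥ k`; it must decide whether `G.const = G₀.const` (YES) or `G.const = ¬G₀.const` (NO),
i.e. output the dual's value at the origin `F̃(0) ⊕ G.const`.  Level `1` = the full partner is given = the ANF slice itself
(`hintSlice_one`, THE ONE EQUIV); level `2` withholds the linear part of the dual; level `3` withholds everything but the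
cubic part; level `≥ 4` withholds the whole dual («compute the dual bit of a bent cubic from `F` alone»).  The levels are
NESTED sub-promises (`hintSlice_mono`), so hardness is MONOTONE in `k` by pure inclusion — no closure property of the class
is used (`hintRungIn_mono`). -/

section Dial

variable {n : ℕ}

/-- Degree of the monomial stored at table position `(i,j,l)`: the number of distinct indices. -/
def posDeg (i j l : Fin n) : ℕ := ({i, j, l} : Finset (Fin n)).card

/-- HintDial helper `one_le_posDeg` (lens-3 g6 HintDial THEOREMS package; see the enclosing section docstring). -/
theorem one_le_posDeg (i j l : Fin n) : 1 ≤ posDeg i j l :=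
  card_pos.2 ⟨i, by simp⟩

/-- HintDial helper `posDeg_le_three` (lens-3 g6 HintDial THEOREMS package; see the enclosing section docstring). -/
theorem posDeg_le_three (i j l : Fin n) : posDeg i j l ≤ 3 := Finset.card_le_three

/-- HintDial helper `posDeg_le_two_of_eq` (lens-3 g6 HintDial THEOREMS package; see the enclosing section docstring). -/
theorem posDeg_le_two_of_eq {i j l : Fin n} (h : i = j) : posDeg i j l ≤ 2 := by
  subst h; unfold posDeg; rw [Finset.insert_eq_of_mem (by simp)]; exact Finset.card_le_two

/-- `G` agrees with `G₀` at all positions of degree `≥ k`. -/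
def CubeAgreeFrom (k : ℕ) (G G₀ : CubicForm n) : Prop :=
  ∀ i j l, k ≤ posDeg i j l → G.cube i j l = G₀.cube i j l

/-- HintDial helper `CubeAgreeFrom.mono` (lens-3 g6 HintDial THEOREMS package; see the enclosing section docstring). -/
theorem CubeAgreeFrom.mono {k k' : ℕ} (hk : k ≤ k') {G G₀ : CubicForm n} (h : CubeAgreeFrom k G G₀) :
    CubeAgreeFrom k' G G₀ := fun i j l hp => h i j l (hk.trans hp)

/-- HintDial helper `CubeAgreeFrom.refl` (lens-3 g6 HintDial THEOREMS package; see the enclosing section docstring). -/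
theorem CubeAgreeFrom.refl (k : ℕ) (G : CubicForm n) : CubeAgreeFrom k G G := fun _ _ _ _ => rfl

/-- HintDial helper `cubeAgreeFrom_one_iff` (lens-3 g6 HintDial THEOREMS package; see the enclosing section docstring). -/
theorem cubeAgreeFrom_one_iff {G G₀ : CubicForm n} : CubeAgreeFrom 1 G G₀ ↔ G.cube = G₀.cube :=
  ⟨fun h => funext fun i => funext fun j => funext fun l => h i j l (one_le_posDeg i j l), fun h i j l _ => by rw [h]⟩

/-- The YES instances at hint level `k`. -/
def hintYes (k : ℕ) : Set CubicANFPair :=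
  {I | Even I.n ∧ ∃ G₀ : CubicForm I.n, (⟨I.n, I.F, G₀⟩ : CubicANFPair).value = 1 ∧ I.G.const = G₀.const ∧ CubeAgreeFrom k I.G G₀}

/-- The NO instances at hint level `k`. -/
def hintNo (k : ℕ) : Set CubicANFPair :=
  {I | Even I.n ∧ ∃ G₀ : CubicForm I.n, (⟨I.n, I.F, G₀⟩ : CubicANFPair).value = 1 ∧ I.G.const = !G₀.const ∧ CubeAgreeFrom k I.G G₀}

/-- ★ HINT LEVEL `k` of the signed exact cubic slice (see the section docstring). -/
def HintSlice (k : ℕ) : PromiseProblem :=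
  ⟨CubicANFPair.encode '' hintYes k, CubicANFPair.encode '' hintNo k⟩

/-- Hint level `k` is hard for the class `C`. -/
def HintRungIn (C : Set (Language Bool)) (k : ℕ) : Prop := HintSlice k ∉ promiseLift C

/-- ★ THE DIAL on the blocker's class `AC⁰[⊕] ∩ P`: `HintRung 1 ⟸ HintRung 2 ⟸ HintRung 3 ⟸ HintRung 4` … wait, read
`hintRung_mono`: hardness INCREASES with `k` (`HintRung k → HintRung k'` for `k ≤ k'`); the blocker is `HintRung 1`. -/
def HintRung (k : ℕ) : Prop := HintRungIn (AC0Mod 2 ∩ Classes.P) k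

/-- The same dial on NON-UNIFORM `AC⁰[⊕]` (each point STRONGER than the uniform one). -/
def HintRungNU (k : ℕ) : Prop := HintRungIn (AC0Mod 2) k

/-- HintDial helper `hintYes_mono` (lens-3 g6 HintDial THEOREMS package; see the enclosing section docstring). -/
theorem hintYes_mono {k k' : ℕ} (hk : k ≤ k') : hintYes k ⊆ hintYes k' :=
  fun _ ⟨he, G₀, hv, hc, ha⟩ => ⟨he, G₀, hv, hc, ha.mono hk⟩

/-- HintDial helper `hintNo_mono` (lens-3 g6 HintDial THEOREMS package; see the enclosing section docstring). -/
theorem hintNo_mono {k k' : ℕ} (hk : k ≤ k') : hintNo k ⊆ hintNo k' :=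
  fun _ ⟨he, G₀, hv, hc, ha⟩ => ⟨he, G₀, hv, hc, ha.mono hk⟩

/-- The levels are nested sub-promises. -/
theorem hintSlice_mono {k k' : ℕ} (hk : k ≤ k') :
    (HintSlice k).yes ≤ (HintSlice k').yes ∧ (HintSlice k).no ≤ (HintSlice k').no :=
  ⟨Set.image_mono (hintYes_mono hk), Set.image_mono (hintNo_mono hk)⟩

/-- ★ MONOTONICITY OF THE DIAL (pure sub-promise inclusion; ANY class `C`). -/
theorem hintRungIn_mono (C : Set (Language Bool)) {k k' : ℕ} (hk : k ≤ k') : HintRungIn C k → HintRungIn C k' :=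
  fun h h' => h (Literature.Computability.Complexity.promiseLift_anti (hintSlice_mono hk).1 (hintSlice_mono hk).2 h')

/-- HintDial helper `hintRung_mono` (lens-3 g6 HintDial THEOREMS package; see the enclosing section docstring). -/
theorem hintRung_mono {k k' : ℕ} (hk : k ≤ k') : HintRung k → HintRung k' := hintRungIn_mono _ hk
/-- HintDial helper `hintRungNU_mono` (lens-3 g6 HintDial THEOREMS package; see the enclosing section docstring). -/
theorem hintRungNU_mono {k k' : ℕ} (hk : k ≤ k') : HintRungNU k → HintRungNU k' := hintRungIn_mono _ hk

/-- HintDial helper `hintRung_of_NU` (lens-3 g6 HintDial THEOREMS package; see the enclosing section docstring). -/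
theorem hintRung_of_NU (k : ℕ) : HintRungNU k → HintRung k :=
  fun h hA => h (promiseLift_mono Set.inter_subset_left hA)

/-- The dial saturates at `4` (no position has degree `≥ 4`). -/
theorem hintSlice_of_four_le {k : ℕ} (hk : 4 ≤ k) : HintSlice k = HintSlice 4 := by
  have hv : ∀ {m : ℕ} (G G₀ : CubicForm m) (j : ℕ), 4 ≤ j → CubeAgreeFrom j G G₀ := fun G G₀ j hj i i' l hp =>
    absurd (hj.trans hp) (by have := posDeg_le_three i i' l; omega)
  have hy : hintYes k = hintYes 4 := Set.ext fun I =>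
    ⟨fun ⟨he, G₀, h1, h2, _⟩ => ⟨he, G₀, h1, h2, hv _ _ _ le_rfl⟩, fun ⟨he, G₀, h1, h2, _⟩ => ⟨he, G₀, h1, h2, hv _ _ _ hk⟩⟩
  have hn : hintNo k = hintNo 4 := Set.ext fun I =>
    ⟨fun ⟨he, G₀, h1, h2, _⟩ => ⟨he, G₀, h1, h2, hv _ _ _ le_rfl⟩, fun ⟨he, G₀, h1, h2, _⟩ => ⟨he, G₀, h1, h2, hv _ _ _ hk⟩⟩
  simp only [HintSlice, hy, hn]

/-! ### THE ONE EQUIV: level 1 IS the ANF slice -/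

/-- HintDial helper `hintYes_one` (lens-3 g6 HintDial THEOREMS package; see the enclosing section docstring). -/
theorem hintYes_one : hintYes 1 = {I | Even I.n ∧ I.value = 1} := by
  ext ⟨m, F, G⟩
  constructor
  · rintro ⟨he, G₀, hv, hc, ha⟩
    have hG : G = G₀ := by
      cases G; cases G₀; simp only at hc; simp only [cubeAgreeFrom_one_iff] at ha; cases hc; cases ha; rfl
    subst hG; exact ⟨he, hv⟩
  · rintro ⟨he, hv⟩
    exact ⟨he, G, hv, rfl, CubeAgreeFrom.refl 1 G⟩

/-- HintDial helper `hintNo_one` (lens-3 g6 HintDial THEOREMS package; see the enclosing section docstring). -/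
theorem hintNo_one : hintNo 1 = {I | Even I.n ∧ I.value = -1} := by
  ext ⟨m, F, G⟩
  constructor
  · rintro ⟨he, G₀, hv, hc, ha⟩
    have hG : G₀ = flipConst G := by
      cases G; cases G₀; simp only at hc; simp only [cubeAgreeFrom_one_iff] at ha; simp [flipConst, hc, ha]
    subst hG
    refine ⟨he, ?_⟩
    have := value_flipConst m F G
    rw [hv] at this
    linarith
  · rintro ⟨he, hv⟩
    refine ⟨he, flipConst G, ?_, by simp [flipConst], fun _ _ _ _ => rfl⟩
    rw [value_flipConst]
    show -(CubicANFPair.value ⟨m, F, G⟩) = 1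
    rw [hv]; norm_num

/-- ★★ THE TRANSLATION (the node's single EQUIV, an equality of promise problems): hint level `1` — the full dual
table is given — is LITERALLY the signed exact cubic ANF slice. -/
theorem hintSlice_one : HintSlice 1 = SignedExactCubicSliceANF := by
  simp only [HintSlice, hintYes_one, hintNo_one]; rfl

/-- ★★ `RungA ⟺ HintRung 1` (and the same for every class). -/
theorem hintRungIn_one_iff (C : Set (Language Bool)) : HintRungIn C 1 ↔ SignedExactCubicSliceANF ∉ promiseLift C := by
  rw [HintRungIn, hintSlice_one]

/-! ### Honesty: every level is a genuine (disjoint) promise problem — by uniqueness of the dual -/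

/-- The constant of an exact `+1` partner of `F` is determined by `F` (it is the dual bit `F̃(0)`). -/
theorem partner_const_unique {m : ℕ} {F G₀ G₁ : CubicForm m}
    (h₀ : (⟨m, F, G₀⟩ : CubicANFPair).value = 1) (h₁ : (⟨m, F, G₁⟩ : CubicANFPair).value = 1) : G₀.const = G₁.const := by
  have h := partner_unique (f := F.eval) h₀ h₁
  rw [← eval_zero G₀, ← eval_zero G₁, h]

/-- ★ Each hint level is a disjoint promise problem. -/
theorem hintSlice_disjoint (k : ℕ) : (HintSlice k).Disjoint := by
  refine Set.disjoint_left.2 ?_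
  rintro w ⟨I, ⟨-, G₀, h₀, hc₀, -⟩, rfl⟩ ⟨J, ⟨-, G₁, h₁, hc₁, -⟩, hJ⟩
  obtain rfl := CubicANFPair.encode_injective hJ
  have hc := partner_const_unique h₀ h₁
  rw [← hc₀] at hc
  rw [hc] at hc₁
  revert hc₁
  generalize G₁.const = b
  cases b <;> decide

/-! ### Junction with generation 4's TRUST FORM (route `TrustDial`, items 29975–29981)

`TrustDial` writes a stratum as `{I | Even I.n ∧ ∃ G', Φ(F,G') = ±1 ∧ G'.const = I.G.const ∧ ∀ i j l, P i j l → G'.cube i j l =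
I.G.cube i j l}` (a `-1` partner with the SAME constant instead of a `+1` partner with the FLIPPED constant — the same set, by
`value_flipConst`).  `hintSlice_eq_trustForm` rewrites any dial level into that shape; with `two_le_posDeg_iff` /
`three_le_posDeg_iff` it gives `HintSlice 2 = trustForm (¬(i = j ∧ j = l))` (= the `ModAffineRung` problem, item 29979, by `Iff.rfl`
in the probe file) and `HintSlice 3 = trustForm (i ≠ j ∧ j ≠ l ∧ i ≠ l)` (= `CubicPartRung`'s problem up to currying). -/

/-- HintDial helper `two_le_posDeg_iff` (lens-3 g6 HintDial THEOREMS package; see the enclosing section docstring). -/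
theorem two_le_posDeg_iff (i j l : Fin n) : 2 ≤ posDeg i j l ↔ ¬ (i = j ∧ j = l) := by
  constructor
  · rintro h ⟨rfl, rfl⟩
    have : posDeg i i i = 1 := by simp [posDeg]
    omega
  · intro h
    unfold posDeg
    rw [Nat.succ_le_iff, Finset.one_lt_card_iff]
    by_cases hij : i = j
    · subst hij
      exact ⟨i, l, by simp, by simp, fun e => h ⟨rfl, e⟩⟩
    · exact ⟨i, j, by simp, by simp, hij⟩

/-- HintDial helper `posDeg_le_two_of_eq` (lens-3 g6 HintDial THEOREMS package; see the enclosing section docstring). -/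
theorem posDeg_le_two_of_eq₂₃ {i j l : Fin n} (h : j = l) : posDeg i j l ≤ 2 := by
  subst h; unfold posDeg; rw [Finset.insert_eq_of_mem (Finset.mem_singleton_self j)]; exact Finset.card_le_two

/-- HintDial helper `posDeg_le_two_of_eq` (lens-3 g6 HintDial THEOREMS package; see the enclosing section docstring). -/
theorem posDeg_le_two_of_eq₁₃ {i j l : Fin n} (h : i = l) : posDeg i j l ≤ 2 := by
  subst h; unfold posDeg
  rw [Finset.insert_eq_of_mem (show i ∈ insert j ({i} : Finset (Fin n)) by simp)]
  exact Finset.card_le_two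

/-- HintDial helper `three_le_posDeg_iff` (lens-3 g6 HintDial THEOREMS package; see the enclosing section docstring). -/
theorem three_le_posDeg_iff (i j l : Fin n) : 3 ≤ posDeg i j l ↔ (i ≠ j ∧ j ≠ l ∧ i ≠ l) := by
  constructor
  · intro h
    refine ⟨fun e => ?_, fun e => ?_, fun e => ?_⟩
    · have := posDeg_le_two_of_eq (l := l) e; omega
    · have := posDeg_le_two_of_eq₂₃ (i := i) e; omega
    · have := posDeg_le_two_of_eq₁₃ (j := j) e; omega
  · rintro ⟨hij, hjl, hil⟩
    exact (Finset.card_eq_three.2 ⟨i, j, l, hij, hil, hjl, rfl⟩).ge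

/-- generation 4's presentation of a trust stratum, for an arbitrary positional predicate `P`. -/
def trustForm (P : ∀ {m : ℕ}, Fin m → Fin m → Fin m → Prop) : PromiseProblem :=
  ⟨CubicANFPair.encode '' {I | Even I.n ∧ ∃ G' : CubicForm I.n, forrelation I.F.eval G'.eval = 1 ∧ G'.const = I.G.const ∧
      ∀ i j l : Fin I.n, P i j l → G'.cube i j l = I.G.cube i j l},
   CubicANFPair.encode '' {I | Even I.n ∧ ∃ G' : CubicForm I.n, forrelation I.F.eval G'.eval = -1 ∧ G'.const = I.G.const ∧
      ∀ i j l : Fin I.n, P i j l → G'.cube i j l = I.G.cube i j l}⟩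

/-- ★ every dial level IS a trust stratum (for the matching positional predicate). -/
theorem hintSlice_eq_trustForm (k : ℕ) (P : ∀ {m : ℕ}, Fin m → Fin m → Fin m → Prop)
    (hP : ∀ {m : ℕ} (i j l : Fin m), k ≤ posDeg i j l ↔ P i j l) : HintSlice k = trustForm P := by
  have hA : ∀ {m : ℕ} (G G₀ : CubicForm m), CubeAgreeFrom k G G₀ ↔ ∀ i j l, P i j l → G₀.cube i j l = G.cube i j l :=
    fun G G₀ => ⟨fun h i j l hp => (h i j l ((hP i j l).2 hp)).symm, fun h i j l hk => (h i j l ((hP i j l).1 hk)).symm⟩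
  have hy : hintYes k = {I | Even I.n ∧ ∃ G' : CubicForm I.n, forrelation I.F.eval G'.eval = 1 ∧ G'.const = I.G.const ∧
      ∀ i j l : Fin I.n, P i j l → G'.cube i j l = I.G.cube i j l} := by
    ext ⟨m, F, G⟩
    constructor
    · rintro ⟨he, G₀, hv, hc, ha⟩
      exact ⟨he, G₀, hv, hc.symm, (hA _ _).1 ha⟩
    · rintro ⟨he, G', hv, hc, ha⟩
      exact ⟨he, G', hv, hc.symm, (hA _ _).2 ha⟩
  have hn : hintNo k = {I | Even I.n ∧ ∃ G' : CubicForm I.n, forrelation I.F.eval G'.eval = -1 ∧ G'.const = I.G.const ∧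
      ∀ i j l : Fin I.n, P i j l → G'.cube i j l = I.G.cube i j l} := by
    ext ⟨m, F, G⟩
    constructor
    · rintro ⟨he, G₀, hv, hc, ha⟩
      refine ⟨he, flipConst G₀, ?_, ?_, (hA _ _).1 ha⟩
      · have h := value_flipConst m F G₀
        rw [hv] at h
        exact h
      · show (!G₀.const) = G.const
        rw [hc]
    · rintro ⟨he, G', hv, hc, ha⟩
      refine ⟨he, flipConst G', ?_, ?_, (hA _ _).2 ha⟩
      · have h := value_flipConst m F G'
        show CubicANFPair.value ⟨m, F, flipConst G'⟩ = 1
        rw [h]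
        show -forrelation F.eval G'.eval = 1
        rw [hv]; norm_num
      · show G.const = !(!G'.const)
        rw [Bool.not_not, hc]
  simp only [HintSlice, hy, hn]
  rfl

/-- ★ level 2 in trust form = generation 4's `ModAffineRung` problem (tree item stmt-QuantumAdvantage-29979). -/
theorem hintSlice_two_eq_trustForm : HintSlice 2 = trustForm (fun i j l => ¬ (i = j ∧ j = l)) :=
  hintSlice_eq_trustForm 2 _ fun i j l => two_le_posDeg_iff i j l

/-- ★ level 3 in trust form (= generation 4's `CubicPartRung` problem, up to currying the distinctness hypotheses). -/
theorem hintSlice_three_eq_trustForm : HintSlice 3 = trustForm (fun i j l => i ≠ j ∧ j ≠ l ∧ i ≠ l) :=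
  hintSlice_eq_trustForm 3 _ fun i j l => three_le_posDeg_iff i j l

/-- ★ `W`-piece in trust form: `HintRung 2 ↔ (ModAffineRung's problem) ∉ promiseLift (AC⁰[⊕] ∩ P)`. -/
theorem hintRung_two_iff_trustForm :
    HintRung 2 ↔ trustForm (fun i j l => ¬ (i = j ∧ j = l)) ∉ promiseLift (AC0Mod 2 ∩ Classes.P) := by
  rw [HintRung, HintRungIn, hintSlice_two_eq_trustForm]

/-- level `4` in trust form: the trusted predicate is EMPTY (no position has positional degree `≥ 4`). -/
theorem hintSlice_four_eq_trustForm : HintSlice 4 = trustForm (fun _ _ _ => False) :=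
  hintSlice_eq_trustForm 4 _ fun i j l => ⟨fun h => by have := posDeg_le_three i j l; omega, False.elim⟩

/-- the trust form with the empty predicate = generation 4's `SoloRung` problem (no agreement clause at all). -/
theorem trustForm_false_eq :
    trustForm (fun _ _ _ => False) =
      ⟨CubicANFPair.encode '' {I | Even I.n ∧ ∃ G' : CubicForm I.n, forrelation I.F.eval G'.eval = 1 ∧ G'.const = I.G.const},
       CubicANFPair.encode '' {I | Even I.n ∧ ∃ G' : CubicForm I.n, forrelation I.F.eval G'.eval = -1 ∧ G'.const = I.G.const}⟩ := by
  have h1 : {I : CubicANFPair | Even I.n ∧ ∃ G' : CubicForm I.n, forrelation I.F.eval G'.eval = 1 ∧ G'.const = I.G.const ∧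
      ∀ i j l : Fin I.n, False → G'.cube i j l = I.G.cube i j l} =
      {I | Even I.n ∧ ∃ G' : CubicForm I.n, forrelation I.F.eval G'.eval = 1 ∧ G'.const = I.G.const} :=
    Set.ext fun I => and_congr_right fun _ => exists_congr fun G' => by simp only [false_imp_iff, imp_true_iff, and_true]
  have h2 : {I : CubicANFPair | Even I.n ∧ ∃ G' : CubicForm I.n, forrelation I.F.eval G'.eval = -1 ∧ G'.const = I.G.const ∧
      ∀ i j l : Fin I.n, False → G'.cube i j l = I.G.cube i j l} =
      {I | Even I.n ∧ ∃ G' : CubicForm I.n, forrelation I.F.eval G'.eval = -1 ∧ G'.const = I.G.const} :=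
    Set.ext fun I => and_congr_right fun _ => exists_congr fun G' => by simp only [false_imp_iff, imp_true_iff, and_true]
  simp only [trustForm, h1, h2]

/-- ★ ANTI-MONOTONICITY IN THE TRUSTED PREDICATE: requiring agreement on FEWER positions enlarges both promise sets, so hardness
transfers from more trust to less trust (for ANY class `C`).  Every order record of generation 4's `DialEdges` (item 29980) is an
instance: `RungA → ModAffineRung → PolarRung → SoloRung`, `ModAffineRung → CubicPartRung`. -/
theorem trustForm_anti (C : Set (Language Bool)) {P P' : ∀ {m : ℕ}, Fin m → Fin m → Fin m → Prop}
    (hPP : ∀ {m : ℕ} (i j l : Fin m), P' i j l → P i j l) :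
    trustForm P ∉ promiseLift C → trustForm P' ∉ promiseLift C := by
  intro h h'
  refine h (Literature.Computability.Complexity.promiseLift_anti ?_ ?_ h')
  · rintro _ ⟨I, ⟨he, G', hv, hc, ha⟩, rfl⟩
    exact ⟨I, ⟨he, G', hv, hc, fun i j l hp => ha i j l (hPP i j l hp)⟩, rfl⟩
  · rintro _ ⟨I, ⟨he, G', hv, hc, ha⟩, rfl⟩
    exact ⟨I, ⟨he, G', hv, hc, fun i j l hp => ha i j l (hPP i j l hp)⟩, rfl⟩

/-- CLAUSE form (second order): the agreement condition as an arbitrary relation between the partner `G'` and the instance's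
`G` — generation 4's items are LITERALLY `trustCl Cl ∉ promiseLift (AC⁰[⊕] ∩ P)` for their (curried) clauses `Cl`, up to `δβ`. -/
def trustCl (Cl : ∀ {m : ℕ}, CubicForm m → CubicForm m → Prop) : PromiseProblem :=
  ⟨CubicANFPair.encode '' {I | Even I.n ∧ ∃ G' : CubicForm I.n, forrelation I.F.eval G'.eval = 1 ∧ G'.const = I.G.const ∧ Cl G' I.G},
   CubicANFPair.encode '' {I | Even I.n ∧ ∃ G' : CubicForm I.n, forrelation I.F.eval G'.eval = -1 ∧ G'.const = I.G.const ∧ Cl G' I.G}⟩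

/-- HintDial helper `trustForm_eq_trustCl` (lens-3 g6 HintDial THEOREMS package; see the enclosing section docstring). -/
theorem trustForm_eq_trustCl (P : ∀ {m : ℕ}, Fin m → Fin m → Fin m → Prop) :
    trustForm P = trustCl (fun G' G => ∀ i j l, P i j l → G'.cube i j l = G.cube i j l) := rfl

/-- ★ ANTI-MONOTONICITY IN THE CLAUSE (any class `C`): a weaker agreement clause gives larger promise sets, so hardness transfers
from the stronger clause to the weaker one.  One lemma for all of generation 4's order records. -/
theorem trustCl_anti (C : Set (Language Bool)) {Cl Cl' : ∀ {m : ℕ}, CubicForm m → CubicForm m → Prop}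
    (hCC : ∀ {m : ℕ} (G' G : CubicForm m), Cl G' G → Cl' G' G) :
    trustCl Cl ∉ promiseLift C → trustCl Cl' ∉ promiseLift C := by
  intro h h'
  refine h (Literature.Computability.Complexity.promiseLift_anti ?_ ?_ h')
  · rintro _ ⟨I, ⟨he, G', hv, hc, ha⟩, rfl⟩
    exact ⟨I, ⟨he, G', hv, hc, hCC _ _ ha⟩, rfl⟩
  · rintro _ ⟨I, ⟨he, G', hv, hc, ha⟩, rfl⟩
    exact ⟨I, ⟨he, G', hv, hc, hCC _ _ ha⟩, rfl⟩

/-- level 1 in trust form (the trusted predicate is everything): the slice itself, g4-style. -/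
theorem hintSlice_one_eq_trustForm : HintSlice 1 = trustForm (fun _ _ _ => True) :=
  hintSlice_eq_trustForm 1 _ fun i j l => ⟨fun _ => trivial, fun _ => one_le_posDeg i j l⟩

end Dial

end Summit.QuantumAdvantage.QuantumAdvantage.Theorems.HintDial

end
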